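import Literature.AlgebraicGeometry.Resolution.SplitDiscNewton
import Literature.AlgebraicGeometry.Resolution.DiscChartCoefficients
import Literature.AlgebraicGeometry.Resolution.DiscInChart
import HarnessLib

/-!
# Members of the disc chart: unit-form products, rational coefficients, fraction forms

Topic: `Literature/AlgebraicGeometry/Resolution` (valued function fields). Groundwork for the
algebraization step of M. Temkin, *Inseparable local uniformization*, J. Algebra 373 (2013) =
arXiv:0804.1554v3, Thm. 3.3.1 (tree: `Temkin2013RelativeCurveSmoothFibre`), level-wise
construction (`RoofDatum.lean`, `RoofCoreE.lean`): the `m°`-side chart is built over the polynomial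
chart `B = m°[x′][1/u]` of the disc `|X − a| ≤ |c|`, `x′ = (x − a)/c`, and three kinds of
bookkeeping are needed to feed `exists_EChart_with_members` and `RoofDatum`:

* `exists_unitFormProduct` — **one unit `u ∈ m°[x′]`, `|u| = 1`, divisible by a unit form of
  each of finitely many polynomials over `m` whose roots are far from `a`** (the product of the
  unit forms of `exists_unitForm_of_forall_isRoot`) — PROVED;
* `div_eval_mem_locAway_of_far_roots` — **a rational function `P(x)/Q(x)` of value `≤ 1` whose
  numerator and denominator have far roots lies in `B`**, for `u` divisible by the unit form of
  `Q` (`DiscChartCoefficients.div_mem_locAway_adjoin_of_unitForms`) — PROVED;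
* `exists_mul_mem_adjoin_integers_of_mem_adjoin` — **clearing constant denominators**: for
  `w ∈ m[S]` there is `e ∈ m° ∖ 0` with `e w ∈ m°[S]` — PROVED;
* `adjoin_x_le_adjoin_x'` — `m[x] ⊆ m[x′]` — PROVED;
* `exists_fractionForm_of_eq_sum`, `exists_fractionForm_of_eq_aeval`,
  `exists_fractionForm_of_mem_adjoin_simple` — **fraction forms**: every `z ∈ m(x)(η)` (`η`
  integral over `m(x)`) has `u z ∈ m°[x′, η]` for some `u ∈ m°[x′] ∖ 0` — PROVED.

All statements are [folklore]; no definitions, no named facts.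

## Sources

* M. Temkin, arXiv:0804.1554v3, proof of Thm. 3.3.1, Steps 2–4 (pp. 44–45).
* F.-V. Kuhlmann, I. Vlahu, Math. Z. 276 (2014), Cor. 7.1 (unit forms), through the tree.
-/

noncomputable section

open Polynomial

namespace Literature.AlgebraicGeometry.Resolution

universe u

variable {Ω : Type u} [Field Ω] (V : ValuationSubring Ω) (m : Subfield Ω)

/-! ### The unit-form product -/

section UnitForms

variable [IsAlgClosed Ω]

/-- **The unit-form product.** For `a, c ∈ m`, `c ≠ 0`, `x′ = (x − a)/c ∈ O_V`, and finitely many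
polynomials `Q` over `m` all of whose roots `ρ` satisfy `|c| < |a − ρ|`, there is
`u ∈ m°[x′]` with `|u|_V = 1` such that for every such `Q` there is a unit form `U_Q` of `Q` at
`(a, c)` (`Q(y) = Q(a) U_Q((y − a)/c)`, `U_Q` over `m`, `U_Q(0) = 1`, higher coefficients of value
`< 1`) with `U_Q(x′) ∣ u` in `m°[x′]`. [folklore] -/
theorem exists_unitFormProduct {a c x : Ω} (ham : a ∈ m) (hcm : c ∈ m) (hc0 : c ≠ 0)
    (hx'V : (x - a) / c ∈ V) (𝒬 : Finset (Polynomial Ω)) (h𝒬m : ∀ Q ∈ 𝒬, ∀ i, Q.coeff i ∈ m)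
    (hfar : ∀ Q ∈ 𝒬, ∀ ρ : Ω, Q.IsRoot ρ → V.valuation c < V.valuation (a - ρ)) :
    ∃ u ∈ Algebra.adjoin (V.toSubring ⊓ m.toSubring : Subring Ω) ({(x - a) / c} : Set Ω),
      V.valuation u = 1 ∧
      ∀ Q ∈ 𝒬, Q.eval a ≠ 0 ∧ ∃ U : Polynomial Ω, (∀ i, U.coeff i ∈ m) ∧ U.coeff 0 = 1 ∧
        (∀ i, 1 ≤ i → V.valuation (U.coeff i) < 1) ∧
        (∀ y : Ω, Q.eval y = Q.eval a * U.eval ((y - a) / c)) ∧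
        ∃ w ∈ Algebra.adjoin (V.toSubring ⊓ m.toSubring : Subring Ω) ({(x - a) / c} : Set Ω),
          U.eval ((x - a) / c) * w = u := by
  classical
  set x' : Ω := (x - a) / c with hx'
  set S := Algebra.adjoin (V.toSubring ⊓ m.toSubring : Subring Ω) ({x'} : Set Ω) with hS
  -- a unit form for each `Q ∈ 𝒬`
  have hQ : ∀ Q : 𝒬, ∃ U : Polynomial Ω, (∀ i, U.coeff i ∈ m) ∧ U.coeff 0 = 1 ∧
      (∀ i, 1 ≤ i → V.valuation (U.coeff i) < 1) ∧
      (∀ y : Ω, (Q : Polynomial Ω).eval y = (Q : Polynomial Ω).eval a * U.eval ((y - a) / c)) :=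
    fun Q => (exists_unitForm_of_forall_isRoot V m ham hcm hc0 (h𝒬m Q Q.2) (hfar Q Q.2)).2
  choose U hUm hU0 hUk hUeval using hQ
  have hUS : ∀ Q : 𝒬, (U Q).eval x' ∈ S := fun Q => eval_unitForm_mem_adjoin V m (hUm Q) (hU0 Q) (hUk Q) x'
  have hUv : ∀ Q : 𝒬, V.valuation ((U Q).eval x') = 1 := fun Q =>
    valuation_eval_unitForm_eq_one V m (hUm Q) (hU0 Q) (hUk Q) V (fun _ _ => Iff.rfl) hx'V
  refine ⟨∏ Q : 𝒬, (U Q).eval x', S.prod_mem fun Q _ => hUS Q, ?_, fun Q hQ => ⟨?_, U ⟨Q, hQ⟩,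
    hUm ⟨Q, hQ⟩, hU0 ⟨Q, hQ⟩, hUk ⟨Q, hQ⟩, hUeval ⟨Q, hQ⟩,
    ∏ Q' ∈ Finset.univ.erase ⟨Q, hQ⟩, (U Q').eval x', S.prod_mem fun Q' _ => hUS Q', ?_⟩⟩
  · rw [map_prod]
    exact Finset.prod_eq_one fun Q _ => hUv Q
  · exact (exists_unitForm_of_forall_isRoot V m ham hcm hc0 (h𝒬m Q hQ) (hfar Q hQ)).1
  · rw [Finset.mul_prod_erase Finset.univ (fun Q' => (U Q').eval x') (Finset.mem_univ _)]

/-- **Rational functions with far roots lie in the disc chart.** `P, Q` over `m` with all roots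
far from `a` (`|c| < |a − ρ|`), `|P(x)/Q(x)| ≤ 1`, and `u ∈ m°[x′]` divisible by a unit form of `Q`
as produced by `exists_unitFormProduct`: then `P(x)/Q(x) ∈ m°[x′][1/u]`. [folklore] -/
theorem div_eval_mem_locAway_of_far_roots {a c x : Ω} (ham : a ∈ m) (hcm : c ∈ m) (hc0 : c ≠ 0)
    (hx'V : (x - a) / c ∈ V) {P Q : Polynomial Ω} (hPm : ∀ i, P.coeff i ∈ m) (hQm : ∀ i, Q.coeff i ∈ m)
    (hfarP : ∀ ρ : Ω, P.IsRoot ρ → V.valuation c < V.valuation (a - ρ))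
    (hfarQ : ∀ ρ : Ω, Q.IsRoot ρ → V.valuation c < V.valuation (a - ρ))
    (hle : V.valuation (P.eval x / Q.eval x) ≤ 1)
    {u : Ω} (hu : u ∈ Algebra.adjoin (V.toSubring ⊓ m.toSubring : Subring Ω) ({(x - a) / c} : Set Ω))
    (hu0 : u ≠ 0)
    {UQ : Polynomial Ω} (hUQm : ∀ i, UQ.coeff i ∈ m) (hUQ0 : UQ.coeff 0 = 1)
    (hUQk : ∀ i, 1 ≤ i → V.valuation (UQ.coeff i) < 1)
    (hUQeval : ∀ y : Ω, Q.eval y = Q.eval a * UQ.eval ((y - a) / c))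
    (hdvd : ∃ w ∈ Algebra.adjoin (V.toSubring ⊓ m.toSubring : Subring Ω) ({(x - a) / c} : Set Ω),
      UQ.eval ((x - a) / c) * w = u) :
    P.eval x / Q.eval x ∈
      locAway (Algebra.adjoin (V.toSubring ⊓ m.toSubring : Subring Ω) ({(x - a) / c} : Set Ω)) u hu := by
  obtain ⟨hQa, -⟩ := exists_unitForm_of_forall_isRoot V m ham hcm hc0 hQm hfarQ
  obtain ⟨-, UP, hUPm, hUP0, hUPk, hUPeval⟩ := exists_unitForm_of_forall_isRoot V m ham hcm hc0 hPm hfarP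
  have hQx : Q.eval x ≠ 0 := by
    rw [hUQeval x]
    refine mul_ne_zero hQa fun h0 => ?_
    have h := valuation_eval_unitForm_eq_one V m hUQm hUQ0 hUQk V (fun _ _ => Iff.rfl) hx'V
    rw [h0, map_zero] at h
    exact zero_ne_one h
  exact div_mem_locAway_adjoin_of_unitForms V m ham hx'V hPm hQm hUPm hUP0 hUPk hUQm hUQ0 hUQk
    (hUPeval x) (hUQeval x) hQx hle hu hdvd hu0

end UnitForms

/-! ### Clearing constant denominators; `m[x] = m[x′]` -/

section Clearing

/-- **Clearing constant denominators.** For `w ∈ m[S]` (the `m`-subalgebra of `Ω` generated by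
`S`) there is a constant `e ∈ m° ∖ 0` with `e w ∈ m°[S]`. [folklore] -/
theorem exists_mul_mem_adjoin_integers_of_mem_adjoin (S : Set Ω) {w : Ω}
    (hw : w ∈ Algebra.adjoin m S) :
    ∃ e ∈ m, e ∈ V ∧ e ≠ 0 ∧ e * w ∈ Algebra.adjoin (V.toSubring ⊓ m.toSubring : Subring Ω) S := by
  set T := Algebra.adjoin (V.toSubring ⊓ m.toSubring : Subring Ω) S with hT
  have hOm : ∀ z : Ω, z ∈ V → z ∈ m → z ∈ T := fun z hzV hzm =>
    T.algebraMap_mem ⟨z, Subring.mem_inf.mpr ⟨hzV, hzm⟩⟩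
  induction hw using Algebra.adjoin_induction with
  | mem z hz => exact ⟨1, m.one_mem, V.one_mem, one_ne_zero, by rw [one_mul]; exact Algebra.subset_adjoin hz⟩
  | algebraMap r =>
    by_cases hr : (r : Ω) ∈ V
    · exact ⟨1, m.one_mem, V.one_mem, one_ne_zero, by rw [one_mul]; exact hOm _ hr r.2⟩
    · have hr0 : (r : Ω) ≠ 0 := fun h0 => hr (by rw [h0]; exact V.zero_mem)
      have hrinv : (r : Ω)⁻¹ ∈ V := by
        rcases V.mem_or_inv_mem (r : Ω) with h | h
        · exact absurd h hr
        · exact h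
      refine ⟨(r : Ω)⁻¹, m.inv_mem r.2, hrinv, inv_ne_zero hr0, ?_⟩
      change (r : Ω)⁻¹ * (r : Ω) ∈ T
      rw [inv_mul_cancel₀ hr0]
      exact T.one_mem
  | add w w' _ _ hw hw' =>
    obtain ⟨e, hem, heV, he0, hew⟩ := hw
    obtain ⟨e', hem', heV', he0', hew'⟩ := hw'
    refine ⟨e * e', m.mul_mem hem hem', V.mul_mem _ _ heV heV', mul_ne_zero he0 he0', ?_⟩
    rw [mul_add]
    refine add_mem ?_ ?_
    · have : e * e' * w = e' * (e * w) := by ring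
      rw [this]; exact T.mul_mem (hOm _ heV' hem') hew
    · have : e * e' * w' = e * (e' * w') := by ring
      rw [this]; exact T.mul_mem (hOm _ heV hem) hew'
  | mul w w' _ _ hw hw' =>
    obtain ⟨e, hem, heV, he0, hew⟩ := hw
    obtain ⟨e', hem', heV', he0', hew'⟩ := hw'
    refine ⟨e * e', m.mul_mem hem hem', V.mul_mem _ _ heV heV', mul_ne_zero he0 he0', ?_⟩
    have : e * e' * (w * w') = (e * w) * (e' * w') := by ring
    rw [this]; exact T.mul_mem hew hew'

/-- **`m[x] ⊆ m[x′]`** for `x′ = (x − a)/c`, `a, c ∈ m`: `x = a + c x′`. [folklore] -/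
theorem adjoin_x_le_adjoin_x' {a c x : Ω} (ham : a ∈ m) (hcm : c ∈ m) (hc0 : c ≠ 0) :
    Algebra.adjoin m ({x} : Set Ω) ≤ Algebra.adjoin m ({(x - a) / c} : Set Ω) := by
  set x' : Ω := (x - a) / c with hx'
  refine Algebra.adjoin_le (Set.singleton_subset_iff.mpr ?_)
  have hx : a + c * x' = x := by rw [hx', mul_div_cancel₀ _ hc0]; ring
  rw [← hx]
  exact add_mem ((Algebra.adjoin m _).algebraMap_mem ⟨a, ham⟩)
    (mul_mem ((Algebra.adjoin m _).algebraMap_mem ⟨c, hcm⟩) (Algebra.subset_adjoin rfl))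

/-- **`m[x, η] ⊆ m[x′, η]`**. [folklore] -/
theorem adjoin_x_eta_le_adjoin_x'_eta {a c x η : Ω} (ham : a ∈ m) (hcm : c ∈ m) (hc0 : c ≠ 0) :
    Algebra.adjoin m ({x, η} : Set Ω) ≤ Algebra.adjoin m ({(x - a) / c, η} : Set Ω) := by
  refine Algebra.adjoin_le ?_
  rintro y (rfl | hy)
  · exact Algebra.adjoin_mono (Set.singleton_subset_iff.mpr (Set.mem_insert _ _))
      (adjoin_x_le_adjoin_x' m ham hcm hc0 (Algebra.subset_adjoin rfl))
  · rw [Set.mem_singleton_iff.mp hy]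
    exact Algebra.subset_adjoin (Set.mem_insert_of_mem _ (Set.mem_singleton _))

end Clearing

/-! ### Fraction forms over `m°[x′, η]` -/

section FractionForms

/-- Elements of the field `m(x) = closure(m ∪ {x})` are quotients of elements of `m[x]`.
[folklore] -/
theorem exists_div_of_mem_closure_insert {x r : Ω}
    (hr : r ∈ Subfield.closure ((m : Set Ω) ∪ {x})) :
    ∃ y ∈ Algebra.adjoin m ({x} : Set Ω), ∃ w ∈ Algebra.adjoin m ({x} : Set Ω), w ≠ 0 ∧ r = y / w := by
  have hsub : Subring.closure ((m : Set Ω) ∪ {x}) ≤ (Algebra.adjoin m ({x} : Set Ω)).toSubring := by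
    refine Subring.closure_le.mpr ?_
    rintro y (hy | hy)
    · exact (Algebra.adjoin m _).algebraMap_mem ⟨y, hy⟩
    · exact Algebra.subset_adjoin hy
  obtain ⟨y, hy, w, hw, hyw⟩ := (Subfield.mem_closure_iff).mp hr
  by_cases hw0 : w = 0
  · refine ⟨0, Subalgebra.zero_mem _, 1, Subalgebra.one_mem _, one_ne_zero, ?_⟩
    rw [← hyw, hw0, div_zero, zero_div]
  · exact ⟨y, hsub hy, w, hsub hw, hw0, hyw.symm⟩

set_option maxHeartbeats 800000 in
/-- **Fraction forms.** Let `a, c ∈ m`, `c ≠ 0`, `x′ = (x − a)/c`, and let `z = Σ_{i<n} rᵢ ηⁱ`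
with all `rᵢ` in the field `m(x) = closure(m ∪ {x})`. Then `u z ∈ m°[x′, η]` for some
`u ∈ m°[x′]`, `u ≠ 0`. [folklore] -/
theorem exists_fractionForm_of_eq_sum {a c x η : Ω} (ham : a ∈ m) (hcm : c ∈ m) (hc0 : c ≠ 0)
    (n : ℕ) (r : ℕ → Ω) (hr : ∀ i, r i ∈ Subfield.closure ((m : Set Ω) ∪ {x})) {z : Ω}
    (hz : z = ∑ i ∈ Finset.range n, r i * η ^ i) :
    ∃ u ∈ Algebra.adjoin (V.toSubring ⊓ m.toSubring : Subring Ω) ({(x - a) / c} : Set Ω), u ≠ 0 ∧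
      u * z ∈ Algebra.adjoin (V.toSubring ⊓ m.toSubring : Subring Ω) ({(x - a) / c, η} : Set Ω) := by
  classical
  have hcoef : ∀ i, ∃ y ∈ Algebra.adjoin m ({x} : Set Ω), ∃ w ∈ Algebra.adjoin m ({x} : Set Ω),
      w ≠ 0 ∧ r i = y / w := fun i => exists_div_of_mem_closure_insert m (hr i)
  choose P hP Q hQ hQ0 hPQ using hcoef
  -- the common denominator `u₀ = ∏ Q_i`
  set u₀ : Ω := ∏ i ∈ Finset.range n, Q i with hu₀
  have hle1 : Algebra.adjoin m ({x} : Set Ω) ≤ Algebra.adjoin m ({(x - a) / c} : Set Ω) :=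
    adjoin_x_le_adjoin_x' m ham hcm hc0
  have hle2 : Algebra.adjoin m ({x} : Set Ω) ≤ Algebra.adjoin m ({(x - a) / c, η} : Set Ω) :=
    hle1.trans (Algebra.adjoin_mono (Set.singleton_subset_iff.mpr (Set.mem_insert _ _)))
  have hu₀m : u₀ ∈ Algebra.adjoin m ({(x - a) / c} : Set Ω) :=
    Subalgebra.prod_mem _ fun i _ => hle1 (hQ i)
  have hu₀0 : u₀ ≠ 0 := Finset.prod_ne_zero_iff.mpr fun i _ => hQ0 i
  -- `u₀ z ∈ m[x′, η]`
  have hu₀z : u₀ * z ∈ Algebra.adjoin m ({(x - a) / c, η} : Set Ω) := by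
    rw [hz, Finset.mul_sum]
    refine Subalgebra.sum_mem _ fun i hi => ?_
    rw [hPQ i]
    have hsplit : u₀ = Q i * ∏ j ∈ (Finset.range n).erase i, Q j := by
      rw [hu₀, Finset.mul_prod_erase _ _ hi]
    have hQP : Q i * (P i / Q i) = P i := mul_div_cancel₀ _ (hQ0 i)
    have : u₀ * (P i / Q i * η ^ i) = (P i * ∏ j ∈ (Finset.range n).erase i, Q j) * η ^ i := by
      rw [hsplit]
      calc Q i * (∏ j ∈ (Finset.range n).erase i, Q j) * (P i / Q i * η ^ i)
          = (∏ j ∈ (Finset.range n).erase i, Q j) * (Q i * (P i / Q i)) * η ^ i := by ring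
        _ = (∏ j ∈ (Finset.range n).erase i, Q j) * P i * η ^ i := by rw [hQP]
        _ = _ := by ring
    rw [this]
    refine Subalgebra.mul_mem _ ?_ (Subalgebra.pow_mem _ (Algebra.subset_adjoin
      (Set.mem_insert_of_mem _ (Set.mem_singleton _))) _)
    exact Subalgebra.mul_mem _ (hle2 (hP i)) (Subalgebra.prod_mem _ fun j _ => hle2 (hQ j))
  -- clear the constant denominators
  obtain ⟨e₁, he₁m, he₁V, he₁0, he₁u⟩ := exists_mul_mem_adjoin_integers_of_mem_adjoin V m _ hu₀m
  obtain ⟨e₂, he₂m, he₂V, he₂0, he₂z⟩ := exists_mul_mem_adjoin_integers_of_mem_adjoin V m _ hu₀z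
  set S₁ := Algebra.adjoin (V.toSubring ⊓ m.toSubring : Subring Ω) ({(x - a) / c} : Set Ω) with hS₁
  set S₂ := Algebra.adjoin (V.toSubring ⊓ m.toSubring : Subring Ω) ({(x - a) / c, η} : Set Ω) with hS₂
  have he₂S₁ : e₂ ∈ S₁ := S₁.algebraMap_mem ⟨e₂, Subring.mem_inf.mpr ⟨he₂V, he₂m⟩⟩
  have he₁S₂ : e₁ ∈ S₂ := S₂.algebraMap_mem ⟨e₁, Subring.mem_inf.mpr ⟨he₁V, he₁m⟩⟩
  refine ⟨e₂ * (e₁ * u₀), S₁.mul_mem he₂S₁ he₁u, mul_ne_zero he₂0 (mul_ne_zero he₁0 hu₀0), ?_⟩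
  have : e₂ * (e₁ * u₀) * z = e₁ * (e₂ * (u₀ * z)) := by ring
  rw [this]
  exact S₂.mul_mem he₁S₂ he₂z

set_option maxHeartbeats 800000 in
/-- **Fraction forms for polynomial expressions in `η` over `m(x)`** (`q` a polynomial over the
subfield `m(x)`, `z = q(η)`). [folklore] -/
theorem exists_fractionForm_of_eq_aeval {a c x η : Ω} (ham : a ∈ m) (hcm : c ∈ m) (hc0 : c ≠ 0)
    (q : Polynomial (Subfield.closure ((m : Set Ω) ∪ {x}))) {z : Ω} (hz : z = Polynomial.aeval η q) :
    ∃ u ∈ Algebra.adjoin (V.toSubring ⊓ m.toSubring : Subring Ω) ({(x - a) / c} : Set Ω), u ≠ 0 ∧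
      u * z ∈ Algebra.adjoin (V.toSubring ⊓ m.toSubring : Subring Ω) ({(x - a) / c, η} : Set Ω) := by
  refine exists_fractionForm_of_eq_sum V m ham hcm hc0 (q.natDegree + 1)
    (fun i => ((q.coeff i : Subfield.closure ((m : Set Ω) ∪ {x})) : Ω)) (fun i => (q.coeff i).2) ?_
  rw [hz, Polynomial.aeval_eq_sum_range]
  refine Finset.sum_congr rfl fun i _ => ?_
  rw [Algebra.smul_def]
  rfl

set_option maxHeartbeats 800000 in
/-- **Fraction forms for elements of `m(x)(η)`**, `η` integral over `m(x)`. [folklore] -/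
theorem exists_fractionForm_of_mem_adjoin_simple {a c x η : Ω} (ham : a ∈ m) (hcm : c ∈ m)
    (hc0 : c ≠ 0) (hη : IsIntegral (Subfield.closure ((m : Set Ω) ∪ {x})) η) {z : Ω}
    (hz : z ∈ IntermediateField.adjoin (Subfield.closure ((m : Set Ω) ∪ {x})) ({η} : Set Ω)) :
    ∃ u ∈ Algebra.adjoin (V.toSubring ⊓ m.toSubring : Subring Ω) ({(x - a) / c} : Set Ω), u ≠ 0 ∧
      u * z ∈ Algebra.adjoin (V.toSubring ⊓ m.toSubring : Subring Ω) ({(x - a) / c, η} : Set Ω) := by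
  set Kx := Subfield.closure ((m : Set Ω) ∪ {x}) with hKx
  have hz' : z ∈ (IntermediateField.adjoin Kx ({η} : Set Ω)).toSubalgebra := hz
  rw [IntermediateField.adjoin_simple_toSubalgebra_of_isAlgebraic hη.isAlgebraic,
    Algebra.adjoin_singleton_eq_range_aeval] at hz'
  obtain ⟨q, hq⟩ := hz'
  exact exists_fractionForm_of_eq_aeval V m ham hcm hc0 q hq.symm

end FractionForms

end Literature.AlgebraicGeometry.Resolution

end
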